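import Literature.Topology.PlanarFoliations.FacialWalk
import Literature.Topology.PlanarFoliations.HugPolygon
import Literature.Topology.PlanarFoliations.PieceHomotopy
import Literature.Topology.PlanarFoliations.WalkVanishing
import HarnessLib

/-!
# The facial petal walk is essential and borders a band of null leaves: the vanishing cycle

Topic: Topology / PlanarFoliations, sequel to `FacialWalk.lean` (the facial cycle data of a
terminal essential petal under the genericity hypothesis). Stage C:

* path algebra over the walk of pieces of cycle data (`exists_const_comp_polyWalk`: a walk of
  pieces each homotopic to a constant path has composite homotopic to a constant path;
  `polyLeafLoop_null_of_base_null`: if a loop reading the base of the walk fence is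
  null-homotopic then so is the leaf loop of the polygon — the converse bridge of
  `CycleLeafPaths`);
* `PolyPattern.fess` (**proved**): **the image of the base loop of the facial walk fence is not
  null-homotopic** — the inner petals are not essential (terminality), so their pieces are
  homotopic to constants, and the remaining piece is that of the essential petal `Z`;
* `PolyPattern.fnull` (**proved**): the planar leaves through the star vertical of the first
  prong point at levels on the side `s` close to the base level are compact and image-null
  (`eventually_compact_imageNull`);
* `PolyPattern.nonempty_vanishingCycle_of_terminal` (**proved**): **a terminal essential petal
  yields a vanishing cycle** (`exists_vanishingCycle_of_walk`).

## References

* C. Camacho, A. Lins Neto, *Geometric Theory of Foliations*, Birkhäuser (1985), Ch. VII §2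
  [CamachoLinsNeto1985].
-/

noncomputable section

open Set Filter Function Metric unitInterval
open _root_.Topology
open Literature.Topology.FourManifolds Literature.Topology.FourManifolds.Foliation Literature.Topology.PlaneTopology

namespace Literature.Topology.PlanarFoliations

/-! ## Path facts -/

section PathFacts

variable {Y : Type*} [TopologicalSpace Y] {a b c a' b' : Y}

/-- Uncasting a homotopy. [folklore] -/
theorem Path.Homotopic.of_cast {p : Path a b} {q : Path a' b'} (ha : a' = a) (hb : b' = b) (h : (p.cast ha hb).Homotopic q) :
    p.Homotopic (q.cast ha.symm hb.symm) := by
  subst ha hb; exact h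

/-- The concatenation of two paths with constant value `x` has constant value `x`. [folklore] -/
theorem Path.trans_apply_const {p : Path a b} {q : Path b c} {x : Y} (hp : ∀ θ, p θ = x) (hq : ∀ θ, q θ = x) (θ : I) :
    (p.trans q) θ = x := by
  rw [Path.trans_apply]; split_ifs <;> simp [hp, hq]

/-- **Cancelling on the left**: `e ≃ e · ch` implies `ch ≃ refl`. [folklore] -/
theorem Path.Homotopic.refl_of_trans_left {e : Path a b} {ch : Path b b} (h : e.Homotopic (e.trans ch)) :
    ch.Homotopic (Path.refl b) := by
  have h1 : (e.symm.trans e).Homotopic (e.symm.trans (e.trans ch)) := (Path.Homotopic.refl _).hcomp h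
  have h2 : (e.symm.trans (e.trans ch)).Homotopic ((e.symm.trans e).trans ch) := (Path.Homotopic.assoc _ _ _).symm
  have h0 : (e.symm.trans e).Homotopic (Path.refl b) := ⟨(Path.Homotopy.reflSymmTrans e).symm⟩
  have h3 : ((e.symm.trans e).trans ch).Homotopic ((Path.refl b).trans ch) := Path.Homotopic.hcomp h0 (Path.Homotopic.refl _)
  have h4 : ((Path.refl b).trans ch).Homotopic ch := Path.Homotopic.refl_trans' _
  exact (Path.Homotopic.trans (Path.Homotopic.trans (Path.Homotopic.trans h0.symm h1) h2) (h3.trans h4)).symm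

end PathFacts

variable {X : Type*} [TopologicalSpace X] [T2Space X] [SecondCountableTopology X] [Nonempty X] {F : Foliation ℝ X} {ι : X → ℂ}
variable {B : Type*} [NormedAddCommGroup B] {M : Type*} [TopologicalSpace M] {T : Foliation B M} {g : ℂ → M}
variable {hbi : IsBiOriented F}

namespace StarData

/-! ## Path algebra over the walk of pieces -/

section Cycle

variable (D : StarData F ι T g) (hι : IsOpenEmbedding ι)
variable {m : ℕ} [NeZero m] {C : Set ℂ} (hC : IsCompact C) {vtx : Fin m → ℂ} {sx : Fin m → X}
  [hnc : ∀ i, NoncompactSpace (F.Leaf (sx i))]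
  (hv : ∀ i, vtx i ∈ D.P) (hmem : ∀ i, ∀ q : F.Leaf (sx i), ι (Leaf.pt q) ∈ C)
  (hω : ∀ i, omegaSet hbi ι (sx i) = {vtx i}) (hα : ∀ i, alphaSet hbi ι (sx (i + 1)) = {vtx i})

/-- **A walk of pieces each homotopic to a constant path has composite homotopic to a constant
path.** [folklore] -/
theorem exists_const_comp_polyWalk (n : ℕ)
    (h : ∀ k < n, ∃ R : Path (D.pos (D.walkJ hι hC hv hmem hω hα k).v) (D.pos (D.walkJ hι hC hv hmem hω hα (k + 1)).v),
      (∀ θ, R θ = D.pos (vtx (idx m 0))) ∧ (D.gPiece hι hC hv hmem hω hα k).Homotopic R) :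
    ∃ R : Path (D.pos (D.walkJ hι hC hv hmem hω hα 0).v) (D.pos (D.walkJ hι hC hv hmem hω hα n).v),
      (∀ θ, R θ = D.pos (vtx (idx m 0))) ∧ (D.polyWalk hι hC hv hmem hω hα n).comp.Homotopic R := by
  induction n with
  | zero => exact ⟨Path.refl _, fun θ ↦ rfl, Path.Homotopic.refl _⟩
  | succ n ih =>
    obtain ⟨R, hR, hhom⟩ := ih fun k hk ↦ h k (Nat.lt_succ_of_lt hk)
    obtain ⟨Rn, hRn, hn⟩ := h n (Nat.lt_succ_self n)
    refine ⟨R.trans (Rn.trans (Path.refl _)), fun θ ↦ Path.trans_apply_const hR (Path.trans_apply_const hRn (fun _ ↦ ?_)) θ, ?_⟩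
    · show D.pos (vtx (idx m (n + 1))) = D.pos (vtx (idx m 0))
      have := hRn 1; rwa [Path.target] at this
    · rw [polyWalk]
      refine (Walk.comp_append _ _).trans ?_
      simp only [Walk.comp_cons, Walk.comp_nil]
      exact hhom.hcomp (hn.hcomp (Path.Homotopic.refl _))

/-- **If a loop reading the base of the walk fence over a period is null-homotopic, the leaf loop
of the polygon is null-homotopic** (the converse bridge). [folklore] -/
theorem polyLeafLoop_null_of_base_null {p : T.LeafSpace} (L : Path p p)
    (hL : ∀ θ, L θ = toLeafSpace (D.walkBase (D.walkJ hι hC hv hmem hω hα) (D.walkℓ hι hC hv hmem hω hα) m θ))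
    (hnull : L.Homotopic (Path.refl p)) : (D.polyLeafLoop hι hC hv hmem hω hα).Homotopic (Path.refl _) := by
  set J := D.walkJ hι hC hv hmem hω hα with hJ
  set ℓ := D.walkℓ hι hC hv hmem hω hα with hℓ
  have hℓc := D.continuous_toLeafSpace_walkℓ hι hC hv hmem hω hα
  have hA := D.baseP_trans_inP J ℓ hℓc m
  have hper := D.walkJ_period hι hC hv hmem hω hα
  -- the base point of `L`
  have hp : p = D.pos (J 0).xpt := by
    rw [← L.source, hL 0, ← D.baseP_apply J ℓ hℓc m 0, Path.source]
  subst hp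
  -- generalise the last junction
  have key : ∀ (Jm : D.WalkJunction hι) (h : Jm = J 0) (base : Path (D.pos (J 0).xpt) (D.pos Jm.xpt))
      (ch : Path (D.pos (J 0).v) (D.pos Jm.v)), (base.trans Jm.inP).Homotopic ((J 0).inP.trans ch) →
      (∀ θ, base θ = L θ) → ∃ R : Path (D.pos (J 0).v) (D.pos Jm.v), (∀ θ, R θ = D.pos (J 0).v) ∧ ch.Homotopic R := by
    intro Jm h base ch hbc hbase
    subst h
    have hbL : base = L := Path.eq_of_forall_eq hbase
    rw [hbL] at hbc
    have h1 : ((J 0).inP).Homotopic ((J 0).inP.trans ch) :=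
      ((Path.Homotopic.refl_trans' _).symm.trans ((hnull.symm).hcomp (Path.Homotopic.refl (J 0).inP))).trans hbc
    exact ⟨Path.refl _, fun θ ↦ rfl, Path.Homotopic.refl_of_trans_left h1⟩
  obtain ⟨R, hR, hch⟩ := key (J m) hper (D.baseP J ℓ hℓc m) (D.chainL J ℓ hℓc m) hA
    (fun θ ↦ by rw [D.baseP_apply, hL])
  rw [D.polyLeafLoop_null_iff hι hC hv hmem hω hα]
  exact ⟨R, hR, (D.comp_polyWalk_homotopic_chainL hι hC hv hmem hω hα m).trans hch⟩

/-- **If every finite piece is homotopic to a constant path, the leaf loop of the polygon is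
null-homotopic.** [folklore] -/
theorem polyLeafLoop_null_of_pieces
    (h : ∀ i : Fin m, ∃ R : Path (D.pos (vtx i)) (D.pos (vtx (i + 1))), (∀ θ, R θ = D.pos (vtx (idx m 0))) ∧
      (D.gPieceFin hι hC hv hmem hω hα i).Homotopic R) :
    (D.polyLeafLoop hι hC hv hmem hω hα).Homotopic (Path.refl _) := by
  rw [D.polyLeafLoop_null_iff hι hC hv hmem hω hα]
  refine D.exists_const_comp_polyWalk hι hC hv hmem hω hα m fun k _ ↦ ?_
  obtain ⟨R, hR, hhom⟩ := h (idx m k)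
  refine ⟨R.cast rfl (congrArg (fun i ↦ D.pos (vtx i)) (idx_succ k)), fun θ ↦ hR θ, ?_⟩
  rw [D.gPiece_eq_cast hι hC hv hmem hω hα k]
  exact Path.Homotopic.cast' hhom _ _

end Cycle

/-! ## The facial walk is essential -/

namespace PolyPattern

variable {D : StarData F ι T g} {hbi : IsBiOriented F} {hι : IsOpenEmbedding ι} (ho : F.IsTransverselyOriented)
  {x₀ : X} (hK₀ : IsCompact (F.leaf x₀)) {hC₀ : IsCompact (discLeaf F ι x₀)} (hΩ : discLeaf F ι x₀ ⊆ D.Ω)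
  (hgen : ∀ (y : X) [NoncompactSpace (F.Leaf y)], (∀ q : F.Leaf y, ι (Leaf.pt q) ∈ discLeaf F ι x₀) →
    ∀ v ∈ D.P, ∀ w ∈ D.P, omegaSet hbi ι y = {v} → alphaSet hbi ι y = {w} → v = w)
  (P : D.PolyPattern hbi hι x₀ hC₀)
  (hterm : ∀ Q : D.PolyPattern hbi hι x₀ hC₀, Q.Z.fill hι hC₀ ⊆ P.Z.fill hι hC₀ → Q.Z.fill hι hC₀ = P.Z.fill hι hC₀)
  (hcterm : ∀ Q : D.CompactPattern x₀, discLeaf F ι Q.y ⊆ P.Z.fill hι hC₀ → discLeaf F ι Q.y = P.Z.fill hι hC₀)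
  {s : ℝ} {m' : ℕ} [NormedSpace ℝ B] [LocallyConnectedSpace B] (hm : P.Z.m = 1) (hs : s = 1 ∨ s = -1) (hs0 : P.InnerSide s P.jin0)
  [NeZero m'] (hper : P.orbit s P.jin0 m' = P.jin0) (hmin : ∀ k, 0 < k → k < m' → P.orbit s P.jin0 k ≠ P.jin0)

/-- The junctions of the facial walk. [folklore] -/
abbrev fJ : ℕ → D.WalkJunction hι :=
  D.walkJ hι hC₀ (P.fhv m') (P.fhmem ho hK₀ hΩ hgen hterm hcterm hm hs hs0) (P.fhω ho hK₀ hΩ hgen hterm hcterm hm hs hs0)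
    (P.fhα ho hK₀ hΩ hgen hterm hcterm hm hs hs0 hper)

/-- The links of the facial walk. [folklore] -/
abbrev fℓ (k : ℕ) : Path (P.fJ ho hK₀ hΩ hgen hterm hcterm hm hs hs0 hper k).Kout.base (P.fJ ho hK₀ hΩ hgen hterm hcterm hm hs hs0 hper (k + 1)).Kin.base :=
  D.walkℓ hι hC₀ (P.fhv m') (P.fhmem ho hK₀ hΩ hgen hterm hcterm hm hs hs0) (P.fhω ho hK₀ hΩ hgen hterm hcterm hm hs hs0)
    (P.fhα ho hK₀ hΩ hgen hterm hcterm hm hs hs0 hper) k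

include ho hK₀ hΩ hgen hterm hcterm hm hs hs0 hmin in
omit [NeZero m'] in
/-- **An inner orbit leaf is inner**: for `0 < k < m'` the leaf `k` of the facial cycle lies
inside. [folklore] -/
theorem fsx_inner {k : Fin m'} (hk : (k : ℕ) ≠ 0) : ι '' F.leaf (P.fsx s m' k) ⊆ P.U := by
  obtain ⟨j, hj⟩ : ∃ j : ℕ, (k : ℕ) = j + 1 := Nat.exists_eq_succ_of_ne_zero hk
  have f := P.stepFacts ho hK₀ hΩ hgen hterm hcterm hm hs (P.orbit_invariant ho hK₀ hΩ hgen hterm hcterm hm hs hs0 j).1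
    (P.orbit_invariant ho hK₀ hΩ hgen hterm hcterm hm hs hs0 j).2 hs0
  rw [P.fsx_of_ne_zero hk, hj]
  have hmem := P.pb_orbit_succ_mem ho hK₀ hΩ hgen hterm hcterm hm hs hs0 j
  rcases f.cases with ⟨-, harr⟩ | hUU
  · exfalso
    refine hmin (j + 1) (Nat.succ_pos j) (by rw [← hj]; exact k.2) ?_
    rw [orbit_succ]; exact harr
  · rw [leaf_eq_of_mem hmem]; exact hUU

include hmin in
/-- **The pieces of the facial cycle along inner leaves are homotopic to constant paths**: the
petal cycle of an inner leaf is not essential (terminality). [cite: CamachoLinsNeto1985, Ch. VII §2] -/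
theorem gPieceFin_inner_null (i : Fin m') (hi : ((i + 1 : Fin m') : ℕ) ≠ 0) :
    ∃ R : Path (D.pos (P.fvtx m' i)) (D.pos (P.fvtx m' (i + 1))), (∀ θ, R θ = D.pos P.v0) ∧
      (D.gPieceFin hι hC₀ (P.fhv m') (P.fhmem ho hK₀ hΩ hgen hterm hcterm hm hs hs0) (P.fhω ho hK₀ hΩ hgen hterm hcterm hm hs hs0)
        (P.fhα ho hK₀ hΩ hgen hterm hcterm hm hs hs0 hper) i).Homotopic R := by
  -- the petal cycle of the inner leaf `y`
  set y := P.fsx s m' (i + 1) with hy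
  have hyU : ι '' F.leaf y ⊆ P.U := P.fsx_inner ho hK₀ hΩ hgen hterm hcterm hm hs hs0 hmin hi
  have hωy : omegaSet hbi ι y = {P.v0} := P.fhω ho hK₀ hΩ hgen hterm hcterm hm hs hs0 (i + 1)
  have hαy : alphaSet hbi ι y = {P.v0} := P.fhα ho hK₀ hΩ hgen hterm hcterm hm hs hs0 hper i
  have hmemy : ∀ q : F.Leaf y, ι (Leaf.pt q) ∈ discLeaf F ι x₀ := P.fhmem ho hK₀ hΩ hgen hterm hcterm hm hs hs0 (i + 1)
  let Q : D.PolyCycle hbi (discLeaf F ι x₀) :=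
    { m := 1, vtx := fun _ ↦ P.v0, sx := fun _ ↦ y, nc := fun _ ↦ P.fsx_nc s m' (i + 1), hv := fun _ ↦ P.v0_mem,
      hmem := fun _ ↦ hmemy, hω := fun _ ↦ hωy, hα := fun _ ↦ hαy, hvtx := fun a b _ ↦ Subsingleton.elim a b,
      hsx := fun a b _ ↦ Subsingleton.elim a b }
  -- not essential
  have hnull : (Q.leafLoop hι hC₀).Homotopic (Path.refl _) := by
    by_contra hess
    have hQ : ∀ j (q : F.Leaf (Q.sx j)), ι (Leaf.pt q) ∈ IsJordanLoop.fill (P.Z.loop hι hC₀) := fun j q ↦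
      Or.inr (hyU ⟨Leaf.pt q, q.2, rfl⟩)
    have hon := P.mem_range_of_essential hbi hι hC₀ hterm Q hQ hess 0 (Leaf.base F y)
    exact P.not_mem_U_of_mem_range hon (hyU ⟨y, F.mem_leaf_self y, rfl⟩)
  -- so the single piece of `Q` is homotopic to a constant
  obtain ⟨R, hR, hcomp⟩ := (D.polyLeafLoop_null_iff hι hC₀ Q.hv Q.hmem Q.omega Q.alpha).1 hnull
  have hg0 : (D.gPiece hι hC₀ Q.hv Q.hmem Q.omega Q.alpha 0).Homotopic R := by
    have h1 : ((D.gPiece hι hC₀ Q.hv Q.hmem Q.omega Q.alpha 0).trans (Path.refl _)).Homotopic R := hcomp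
    exact (Path.Homotopic.trans_refl' _).symm.trans h1
  rw [D.gPiece_eq_cast hι hC₀ Q.hv Q.hmem Q.omega Q.alpha 0] at hg0
  -- and the piece of the facial cycle is homotopic to it
  have hcmp := D.gPieceFin_homotopic hι hC₀ Q.hv Q.hmem Q.omega Q.alpha hC₀ (P.fhv m') (P.fhmem ho hK₀ hΩ hgen hterm hcterm hm hs hs0)
    (P.fhω ho hK₀ hΩ hgen hterm hcterm hm hs hs0) (P.fhα ho hK₀ hΩ hgen hterm hcterm hm hs hs0 hper) (idx 1 0) i rfl rfl rfl
  have hg0' := Path.Homotopic.of_cast _ _ hg0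
  refine ⟨_, ?_, hcmp.trans (Path.Homotopic.cast' hg0' _ _)⟩
  intro θ
  exact hR θ

/-- **The last piece of the facial cycle is homotopic to the piece of the petal `Z`.** [folklore] -/
theorem gPieceFin_last (i : Fin m') (hi : ((i + 1 : Fin m') : ℕ) = 0) :
    ∃ (a : P.fvtx m' i = P.Z.vtx 0) (b : P.fvtx m' (i + 1) = P.Z.vtx (0 + 1)),
      (D.gPieceFin hι hC₀ (P.fhv m') (P.fhmem ho hK₀ hΩ hgen hterm hcterm hm hs hs0) (P.fhω ho hK₀ hΩ hgen hterm hcterm hm hs hs0)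
        (P.fhα ho hK₀ hΩ hgen hterm hcterm hm hs hs0 hper) i).Homotopic
        ((D.gPieceFin hι hC₀ P.Z.hv P.Z.hmem P.Z.omega P.Z.alpha 0).cast (congrArg D.pos a) (congrArg D.pos b)) := by
  have h01 : (0 : Fin P.Z.m) + 1 = 0 := P.fin_eq_zero hm _
  have a : P.fvtx m' i = P.Z.vtx 0 := rfl
  have b : P.fvtx m' (i + 1) = P.Z.vtx (0 + 1) := by rw [h01]; rfl
  have hyy : P.fsx s m' (i + 1) = P.Z.sx (0 + 1) := by rw [h01, P.fsx_of_eq_zero hi]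
  exact ⟨a, b, D.gPieceFin_homotopic hι hC₀ P.Z.hv P.Z.hmem P.Z.omega P.Z.alpha hC₀ (P.fhv m')
    (P.fhmem ho hK₀ hΩ hgen hterm hcterm hm hs hs0) (P.fhω ho hK₀ hΩ hgen hterm hcterm hm hs hs0)
    (P.fhα ho hK₀ hΩ hgen hterm hcterm hm hs hs0 hper) 0 i a b hyy⟩

include hmin in
/-- **The base loop of the facial walk fence is essential.** [cite: CamachoLinsNeto1985, Ch. VII §2] -/
theorem fess {p : T.LeafSpace} (L : Path p p)
    (hL : ∀ θ, L θ = toLeafSpace (D.walkBase (P.fJ ho hK₀ hΩ hgen hterm hcterm hm hs hs0 hper)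
      (P.fℓ ho hK₀ hΩ hgen hterm hcterm hm hs hs0 hper) m' θ)) : ¬ L.Homotopic (Path.refl p) := by
  intro hnull
  -- the leaf loop of the facial cycle is null
  have hf := D.polyLeafLoop_null_of_base_null hι hC₀ (P.fhv m') (P.fhmem ho hK₀ hΩ hgen hterm hcterm hm hs hs0)
    (P.fhω ho hK₀ hΩ hgen hterm hcterm hm hs hs0) (P.fhα ho hK₀ hΩ hgen hterm hcterm hm hs hs0 hper) L hL hnull
  rw [D.polyLeafLoop_null_iff] at hf
  obtain ⟨R, hR, hcomp⟩ := hf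
  -- split off the last piece
  obtain ⟨n, hn⟩ : ∃ n, m' = n + 1 := Nat.exists_eq_succ_of_ne_zero (NeZero.ne m')
  subst hn
  have hinner : ∀ k < n, ∃ R' : Path (D.pos (P.fJ ho hK₀ hΩ hgen hterm hcterm hm hs hs0 hper k).v)
      (D.pos (P.fJ ho hK₀ hΩ hgen hterm hcterm hm hs hs0 hper (k + 1)).v), (∀ θ, R' θ = D.pos (P.fvtx (n + 1) (idx (n + 1) 0))) ∧
      (D.gPiece hι hC₀ (P.fhv (n + 1)) (P.fhmem ho hK₀ hΩ hgen hterm hcterm hm hs hs0) (P.fhω ho hK₀ hΩ hgen hterm hcterm hm hs hs0)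
        (P.fhα ho hK₀ hΩ hgen hterm hcterm hm hs hs0 hper) k).Homotopic R' := by
    intro k hk
    have hi : ((idx (n + 1) k + 1 : Fin (n + 1)) : ℕ) ≠ 0 := by
      rw [← idx_succ, idx_val, Nat.mod_eq_of_lt (by omega)]; omega
    obtain ⟨R', hR', hhom⟩ := P.gPieceFin_inner_null ho hK₀ hΩ hgen hterm hcterm hm hs hs0 hper hmin (idx (n + 1) k) hi
    refine ⟨R'.cast rfl (congrArg (fun i ↦ D.pos (P.fvtx (n + 1) i)) (idx_succ k)), fun θ ↦ hR' θ, ?_⟩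
    rw [D.gPiece_eq_cast]
    exact Path.Homotopic.cast' hhom _ _
  obtain ⟨R₁, hR₁, h₁⟩ := D.exists_const_comp_polyWalk hι hC₀ (P.fhv (n + 1)) (P.fhmem ho hK₀ hΩ hgen hterm hcterm hm hs hs0)
    (P.fhω ho hK₀ hΩ hgen hterm hcterm hm hs hs0) (P.fhα ho hK₀ hΩ hgen hterm hcterm hm hs hs0 hper) n hinner
  -- all the paths are loops at `pos v0`: constants are `refl`
  have hR₁' : R₁ = Path.refl _ := Path.eq_refl_of_forall_eq hR₁
  have hR' : R = Path.refl _ := Path.eq_refl_of_forall_eq hR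
  set gl := D.gPiece hι hC₀ (P.fhv (n + 1)) (P.fhmem ho hK₀ hΩ hgen hterm hcterm hm hs hs0) (P.fhω ho hK₀ hΩ hgen hterm hcterm hm hs hs0)
    (P.fhα ho hK₀ hΩ hgen hterm hcterm hm hs hs0 hper) n with hgl
  have hsplit : ((D.polyWalk hι hC₀ (P.fhv (n + 1)) (P.fhmem ho hK₀ hΩ hgen hterm hcterm hm hs hs0) (P.fhω ho hK₀ hΩ hgen hterm hcterm hm hs hs0)
      (P.fhα ho hK₀ hΩ hgen hterm hcterm hm hs hs0 hper) (n + 1)).comp).Homotopic (R₁.trans (gl.trans (Path.refl _))) := by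
    rw [polyWalk]
    refine (Walk.comp_append _ _).trans ?_
    simp only [Walk.comp_cons, Walk.comp_nil]
    exact h₁.hcomp (Path.Homotopic.refl _)
  have hgl_null : gl.Homotopic (Path.refl _) := by
    have h2 : (R₁.trans (gl.trans (Path.refl _))).Homotopic gl := by
      rw [hR₁']; exact (Path.Homotopic.refl_trans' _).trans (Path.Homotopic.trans_refl' _)
    have h3 := (hsplit.symm.trans hcomp)
    rw [hR'] at h3
    exact h2.symm.trans h3
  -- the last piece is the piece of `Z`
  have hlast : ((idx (n + 1) n + 1 : Fin (n + 1)) : ℕ) = 0 := by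
    rw [← idx_succ, idx_val, Nat.mod_self]
  obtain ⟨a, b, hZ⟩ := P.gPieceFin_last ho hK₀ hΩ hgen hterm hcterm hm hs hs0 hper (idx (n + 1) n) hlast
  rw [hgl, D.gPiece_eq_cast] at hgl_null
  have hZnull : ((D.gPieceFin hι hC₀ P.Z.hv P.Z.hmem P.Z.omega P.Z.alpha 0).cast (congrArg D.pos a) (congrArg D.pos b)).Homotopic
      ((Path.refl _).cast (rfl : D.pos (P.fvtx (n + 1) (idx (n + 1) n)) = _)
        ((congrArg (fun i ↦ D.pos (P.fvtx (n + 1) i)) (idx_succ n)).symm)) :=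
    hZ.symm.trans (Path.Homotopic.of_cast _ _ hgl_null)
  have hZ0 := Path.Homotopic.of_cast _ _ hZnull
  -- hence the leaf loop of `Z` is null: contradiction
  refine P.ess (D.polyLeafLoop_null_of_pieces hι hC₀ P.Z.hv P.Z.hmem P.Z.omega P.Z.alpha fun i ↦ ?_)
  obtain rfl : i = 0 := P.fin_eq_zero hm i
  exact ⟨_, fun θ ↦ rfl, hZ0⟩

/-! ## The band of null leaves at the first prong point -/

include hmin in
omit [NeZero m'] in
/-- **Near the base level on the side `s`, the planar leaves through the star vertical of the
first prong point are compact and image-null.** [cite: CamachoLinsNeto1985, Ch. VII §2] -/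
theorem fnull [NeZero m'] : ∃ δ₀ > 0, ∀ t ∈ Ioo 0 δ₀,
    IsCompact (F.leaf ((P.fJ ho hK₀ hΩ hgen hterm hcterm hm hs hs0 hper 0).Kin.T₁ (P.fJ ho hK₀ hΩ hgen hterm hcterm hm hs hs0 hper 0).χ₀
      ((P.fJ ho hK₀ hΩ hgen hterm hcterm hm hs hs0 hper 0).τ₀ + s * t))) ∧
    ImageNull D.foliated ((P.fJ ho hK₀ hΩ hgen hterm hcterm hm hs hs0 hper 0).Kin.T₁ (P.fJ ho hK₀ hΩ hgen hterm hcterm hm hs hs0 hper 0).χ₀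
      ((P.fJ ho hK₀ hΩ hgen hterm hcterm hm hs hs0 hper 0).τ₀ + s * t)) := by
  set J0 := P.fJ ho hK₀ hΩ hgen hterm hcterm hm hs hs0 hper 0 with hJ0
  set Jc := D.jc hι hC₀ (P.fhv m') (P.fhmem ho hK₀ hΩ hgen hterm hcterm hm hs hs0) (P.fhω ho hK₀ hΩ hgen hterm hcterm hm hs hs0)
    (P.fhα ho hK₀ hΩ hgen hterm hcterm hm hs hs0 hper) (idx m' 0) with hJc
  set Pv := P.Pv with hPv
  -- the first junction: prong `jin0`, parameter `β ∈ (0, ρ]`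
  have hjin : J0.jin = P.jin0 := by
    obtain ⟨E, hE⟩ := P.ftail_fsx ho hK₀ hΩ hgen hterm hcterm hm hs hs0 (idx m' 0)
    show Jc.Ef.j = P.jin0
    rw [ProngStar.FwdTail.j_eq Jc.Ef E, hE, idx_val, Nat.zero_mod]; rfl
  have hβ : J0.β ∈ Ioc 0 Pv.ρ := ⟨Jc.hβout.1, Jc.hβout.2.trans Jc.Eb.hβ₀.2⟩
  have hT₁ : ∀ τ, J0.Kin.T₁ J0.χ₀ τ = Pv.horiz hι J0.jin (J0.χ₀ τ) J0.β := fun τ ↦ rfl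
  -- the inner side, and the star vertical as a path in the height
  obtain ⟨δ, hδ, hδU⟩ := hs0.ev
  have hχc : Continuous J0.χ₀ := J0.χ₀.continuous
  have hχ0 : J0.χ₀ J0.τ₀ = 0 := J0.χ₀_τ₀
  set hgt : ℝ → ℝ := fun t ↦ J0.χ₀ (J0.τ₀ + s * t) with hhgt
  have hhc : Continuous hgt := hχc.comp (continuous_const.add (continuous_const.mul continuous_id))
  have hh0 : hgt 0 = 0 := by simp only [hhgt, mul_zero, add_zero]; exact hχ0
  have hsign : ∀ t, 0 < t → 0 < s * hgt t := by
    intro t ht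
    rcases hs with rfl | rfl
    · have : J0.χ₀ J0.τ₀ < J0.χ₀ (J0.τ₀ + 1 * t) := J0.χ₀.strictMono (by linarith)
      rw [hχ0] at this; simpa [hhgt] using this
    · have : J0.χ₀ (J0.τ₀ + -1 * t) < J0.χ₀ J0.τ₀ := J0.χ₀.strictMono (by linarith)
      rw [hχ0] at this; simp only [hhgt]; linarith
  obtain ⟨t₁, ht₁, hsmall⟩ : ∃ t₁ > 0, ∀ t, |t| < t₁ → |hgt t| < min δ Pv.ρ := by
    have := Metric.continuousAt_iff.1 (hhc.continuousAt (x := (0 : ℝ))) (min δ Pv.ρ) (lt_min hδ Pv.ρ_pos)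
    obtain ⟨t₁, ht₁, h⟩ := this
    exact ⟨t₁, ht₁, fun t ht ↦ by have := h (by rwa [dist_zero_right, Real.norm_eq_abs]); rwa [hh0, dist_zero_right, Real.norm_eq_abs] at this⟩
  set sg : ℝ → X := fun t ↦ Pv.horiz hι J0.jin (hgt t) J0.β with hsg
  have hsg0 : sg 0 = Pv.horiz hι P.jin0 0 J0.β := by simp only [hsg, hh0, hjin]
  have hsgc : ContinuousWithinAt sg (Ioo 0 t₁) 0 := by
    have h1 : ContinuousAt (fun h ↦ Pv.horiz hι J0.jin h J0.β) (hgt 0) := by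
      rw [hh0]; exact (Pv.continuousOn_horiz_vert hι J0.jin hβ).continuousAt (Icc_mem_nhds (by linarith [Pv.ρ_pos]) Pv.ρ_pos)
    exact (h1.comp hhc.continuousAt).continuousWithinAt
  have hsgtr : ι (sg 0) ∈ range (P.Z.loop hι hC₀) := by rw [hsg0]; exact P.mem_range_of_mem_leaf (P.horiz_jin0_mem hβ)
  have hsgA : ∀ t ∈ Ioo 0 t₁, ι (sg t) ∈ IsJordanLoop.inside (P.Z.loop hι hC₀) := by
    intro t ht
    have h1 := hsmall t (by rw [abs_of_pos ht.1]; exact ht.2)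
    have := hδU J0.β hβ (hgt t) (hsign t ht.1) (h1.trans_le (min_le_left _ _))
    rwa [← hjin] at this
  have hev := D.eventually_compact_imageNull hbi hι ho hC₀ hΩ (P.Z.isJordanLoop_loop hι hC₀) (P.fill_subset hK₀)
    (fun _ hx' _ hx'' ↦ P.Z.range_loop_saturated hι hC₀ hx' hx'') (P.imageNull_of_compact_inside hbi hι hK₀ hC₀ hcterm)
    (P.mem_range_of_essential hbi hι hC₀ hterm)
    (fun xk _ ↦ by
      obtain ⟨e, he, hxe⟩ := F.exists_mem_source xk
      exact ⟨e, he, hxe, P.Z.trace_eq_plaque_near hι hC₀ xk he hxe⟩) hsgc hsgtr hsgA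
  rw [eventually_nhdsWithin_iff, Metric.eventually_nhds_iff] at hev
  obtain ⟨δ₁, hδ₁, h⟩ := hev
  refine ⟨min δ₁ t₁, lt_min hδ₁ ht₁, fun t ht ↦ ?_⟩
  have := h (show dist t 0 < δ₁ by rw [dist_zero_right, Real.norm_eq_abs, abs_of_pos ht.1]; exact ht.2.trans_le (min_le_left _ _))
    ⟨ht.1, ht.2.trans_le (min_le_right _ _)⟩
  rw [hT₁]
  exact this

/-! ## The vanishing cycle of a terminal essential petal -/

omit [NeZero m'] [T2Space X] [SecondCountableTopology X] [NormedSpace ℝ B] [LocallyConnectedSpace B] in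
/-- The base horizontal of a walk lies in the image of the disc map `g`. [folklore] -/
theorem _root_.Literature.Topology.PlanarFoliations.StarData.walkBase_mem_range (J : ℕ → D.WalkJunction hι)
    (ℓ : ∀ k, Path (J k).Kout.base (J (k + 1)).Kin.base) : ∀ n θ, D.walkBase J ℓ n θ ∈ range g := by
  intro n
  induction n with
  | zero => intro θ; exact ⟨_, rfl⟩
  | succ n ih =>
    intro θ
    rw [walkBase, transFun]
    split_ifs
    · rw [transFun]
      split_ifs
      · exact ih _
      · rw [WalkJunction.gateBase, transFun]
        split_ifs
        · rw [transFun]; split_ifs <;> exact ⟨_, rfl⟩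
        · exact ⟨_, rfl⟩
    · exact ⟨_, rfl⟩

omit [NeZero m'] in
include ho hK₀ hΩ hgen P hterm hcterm in
/-- **A terminal essential polygon yields a vanishing cycle** (generic case), whose essential
loop lies in the image of the disc map. [cite: CamachoLinsNeto1985, Ch. VII §2] -/
theorem exists_vanishingCycle_of_terminal : ∃ C : T.VanishingCycle, ∀ θ, C.fam 0 θ ∈ range g := by
  haveI : Nontrivial X := nontrivial_of_foliation F x₀
  have hm : P.Z.m = 1 := P.Z.m_eq_one hbi hgen
  obtain ⟨s, hs, hs0⟩ := P.exists_innerSide_jin0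
  obtain ⟨m', hm'pos, hper, hmin⟩ := P.exists_period ho hK₀ hΩ hgen hterm hcterm hm hs hs0
  haveI : NeZero m' := ⟨hm'pos.ne'⟩
  obtain ⟨δ₀, hδ₀, hnull⟩ := P.fnull ho hK₀ hΩ hgen hterm hcterm hm hs hs0 hper hmin
  obtain ⟨C, -, hC⟩ := D.exists_vanishingCycle_of_walk hι hbi ho (P.fJ ho hK₀ hΩ hgen hterm hcterm hm hs hs0 hper)
    (P.fℓ ho hK₀ hΩ hgen hterm hcterm hm hs hs0 hper)
    (D.continuous_toLeafSpace_walkℓ hι hC₀ (P.fhv m') (P.fhmem ho hK₀ hΩ hgen hterm hcterm hm hs hs0)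
      (P.fhω ho hK₀ hΩ hgen hterm hcterm hm hs hs0) (P.fhα ho hK₀ hΩ hgen hterm hcterm hm hs hs0 hper))
    hs (P.fturn ho hK₀ hΩ hgen hterm hcterm hm hs hs0 hper) (D.walkJ_period hι hC₀ _ _ _ _)
    (fun L hL ↦ P.fess ho hK₀ hΩ hgen hterm hcterm hm hs hs0 hper hmin L hL) hδ₀ hnull
  refine ⟨C, fun θ ↦ ?_⟩
  rw [hC 0 θ, mul_zero, add_zero, WalkFenceData.Φ_base]
  exact D.walkBase_mem_range _ _ _ _

end PolyPattern

end StarData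

end Literature.Topology.PlanarFoliations
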